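import Summits.ResolutionOfSingularities.ResolutionOfSingularities.Theorems.FrobeniusClosingPatchingRelPerfectCoreRungTowerCharts
import Literature.AlgebraicGeometry.Resolution.BlowupAlgebraStrictTransform
import Literature.AlgebraicGeometry.Resolution.BlowupAlgebraPresentation
import Literature.AlgebraicGeometry.Resolution.AffineBlowupResolutionCriterion
import HarnessLib

/-!
# Crux `PatchingRelPerfect` (stmt-ResolutionOfSingularities-16161), chain w52 — rung tool:
# the STRICT TRANSFORM OF A COORDINATE SUB-FAMILY on a Rees chart (ring level, any ring)

[OURS · L1 W5.2 · rung tool, kernel (iii) support] Setting: ANY commutative ring `R`, a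
quasi-regular family `x : Fin n → R`, `I = (x)`, the Rees chart `B = (R[It])_{(x_i t)}` of
`Bl_I Spec R` at a generator `x_i` (`chartRing x i`, structure map `chartBase x i`, generators
`e_j = chartGen x i j`, `x_j = x_i e_j`), and a set `J` of indices `j ≠ i` (enumerated by `jJ`),
with complement enumerated by `emb : Fin n' → Fin n`, `i = emb i'`.  The closed subscheme
`V(x_j : j ∈ J) ⊇ V(I)` of `Spec R` CONTAINS the centre, so its strict transform is its own
blowing up `Bl_{Ī} Spec R̄`, `R̄ = R/(x_J)`, `Ī = (x̄_{emb k})_k` (Görtz–Wedhorn, Prop. 13.96 (2)),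
and on the chart it is cut out by the `e_j`, `j ∈ J`.  PROVED (no hypothesis on `R` beyond
quasi-regularity of `x`):

* `exists_strictTransformHom` — **`B ⧸ (e_j : j ∈ J) ≅ B̄`**, `B̄ = (R̄[Īt])_{(x̄_i t)}` the Rees
  chart of the reduced family `x̄ = (x̄_{emb k})_k` over `R̄ = R/(x_J)`, sending `r/1 ↦ r̄/1` and
  `e_{emb k} ↦ ē_k`.  The chart map `B → B̄` (through the affine models `R[I/x_i] → R̄[Ī/x̄_i]`,
  `blowupAlgebraMap`, and the bridges `toBlowupAlgebra`) is surjective with kernel the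
  `x_i`-saturation of `(x_J) B = x_i · (e_J)` (`mem_ker_blowupAlgebraMap_iff`), and that
  saturation is `(e_J)` itself because `x_i` is regular modulo `(e_J)`:
* `mem_of_mul_mem_of_isWeaklyRegular_cons` — the elementary **swap lemma**: if `a :: es` is a
  weakly regular sequence on a commutative ring then `a` is regular modulo `(es)` (induction on
  the length of `es`, peeling the last member); applied to the chart family `(x_i, e_J)`
  (`CoreRungTower.isWeaklyRegular_chartFamily`, Stacks 0BIQ);
* consequences used by the rung certificates: `isRegularRing_quotient_span_chartGen`
  (`B ⧸ (e_J)` is a regular ring when `R̄` is regular, `x̄` quasi-regular and `R̄/Ī` regular —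
  Liu Thm. 8.1.19 (a) on `B̄`) and `mk_chartBase_mem_nonZeroDivisors` (a `r ∈ R` that is a
  non-zero-divisor modulo `(x_J)` stays a non-zero-divisor of `B ⧸ (e_J)`).

This is the persistence input for towers of blowing ups whose later centres are strict
transforms of coordinate subspaces through the earlier centres (the LINE STEPS of the cusp
member `(x₃² + x₀³) + 𝔪⁴`, this seat's note `NONGRADED-CUSP-MEMBER.md`, evidence #52 on the crux
item).  FORMAT evidence / tool only (CHAIN §1 (A), (C)); nothing here is a statement of the
manuscript under review.

## References

* U. Görtz, T. Wedhorn, *Algebraic Geometry I* (2nd ed., 2020), Prop. 13.96 (2), p. 416.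
  [GortzWedhorn2020]
* The Stacks Project, Tags 0804, 0BIQ, 080A. [StacksProject]
* Q. Liu, *Algebraic Geometry and Arithmetic Curves*, OUP 2002, Thm. 8.1.19 (a). [Liu2002]
-/

-- `Summit.<Summit>.<Sub>.Theorems` with `Sub = Summit` (single-conjunct summit, D-0017)
set_option linter.dupNamespace false

noncomputable section

open CategoryTheory CategoryTheory.Limits AlgebraicGeometry Literature.AlgebraicGeometry.Resolution
open scoped Pointwise

namespace Summit.ResolutionOfSingularities.ResolutionOfSingularities.Theorems

universe u

namespace ChartStrictTransform

/-! ## The swap lemma: the head of a weakly regular sequence is regular modulo the tail -/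

/-- In a commutative ring, regularity of `r` on the quotient MODULE `B ⧸ I•B` means
`r g ∈ I ⇒ g ∈ I`. [folklore] -/
theorem mem_of_mul_mem_of_isSMulRegular {B : Type*} [CommRing B] {I : Ideal B} {r : B}
    (h : IsSMulRegular (B ⧸ (I • ⊤ : Submodule B B)) r) {g : B} (hg : r * g ∈ I) : g ∈ I := by
  have hI : (I • ⊤ : Submodule B B) = I := by rw [smul_eq_mul, Ideal.mul_top]
  have h0 : (Submodule.Quotient.mk g : B ⧸ (I • ⊤ : Submodule B B)) = 0 := by
    apply h
    dsimp only
    rw [smul_zero, ← Submodule.Quotient.mk_smul, Submodule.Quotient.mk_eq_zero, hI, smul_eq_mul]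
    exact hg
  rw [Submodule.Quotient.mk_eq_zero, hI] at h0
  exact h0

/-- **Swap lemma.** If `a :: es` is a weakly regular sequence on the commutative ring `B`, then
`a` is regular modulo `(es)`: `a g ∈ (es) ⇒ g ∈ (es)` (induction on `es`, peeling off its last
member `e`: from `a g = s + h e` one gets `e h ∈ (a, es')`, so `h ∈ (a, es')` by regularity of
`e`, and then `a (g - p e) ∈ (es')`). [folklore] -/
theorem mem_of_mul_mem_of_isWeaklyRegular_cons {B : Type*} [CommRing B] {a : B} :
    ∀ {es : List B}, RingTheory.Sequence.IsWeaklyRegular B (a :: es) →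
      ∀ {g : B}, a * g ∈ Ideal.ofList es → g ∈ Ideal.ofList es := by
  intro es
  induction es using List.reverseRecOn with
  | nil =>
    intro h g hg
    rw [RingTheory.Sequence.isWeaklyRegular_singleton_iff] at h
    rw [Ideal.ofList_nil, Ideal.mem_bot] at hg ⊢
    apply h
    dsimp only
    rw [smul_eq_mul, smul_eq_mul, hg, mul_zero]
  | append_singleton es e ih =>
    intro h g hg
    have h' : RingTheory.Sequence.IsWeaklyRegular B ((a :: es) ++ [e]) := h
    rw [RingTheory.Sequence.isWeaklyRegular_append_iff,
      RingTheory.Sequence.isWeaklyRegular_singleton_iff] at h'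
    obtain ⟨h1, h2⟩ := h'
    rw [Ideal.ofList_append, Ideal.ofList_singleton] at hg ⊢
    obtain ⟨s, hs, w, hw, hsw⟩ := Submodule.mem_sup.mp hg
    obtain ⟨hh, rfl⟩ := Ideal.mem_span_singleton'.mp hw
    -- `e · hh ∈ (a, es)`, hence `hh ∈ (a, es)`
    have hehh : e * hh ∈ Ideal.ofList (a :: es) := by
      rw [Ideal.ofList_cons]
      have : e * hh = a * g - s := by rw [← hsw]; ring
      rw [this]
      exact Ideal.sub_mem _ (Ideal.mem_sup_left (Ideal.mem_span_singleton'.mpr ⟨g, mul_comm g a⟩))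
        (Ideal.mem_sup_right hs)
    have hhh : hh ∈ Ideal.ofList (a :: es) := mem_of_mul_mem_of_isSMulRegular h2 hehh
    rw [Ideal.ofList_cons] at hhh
    obtain ⟨pa, hpa, s', hs', hps⟩ := Submodule.mem_sup.mp hhh
    obtain ⟨p, rfl⟩ := Ideal.mem_span_singleton'.mp hpa
    -- `a (g - p e) = s + s' e ∈ (es)`
    have hkey : a * (g - p * e) ∈ Ideal.ofList es := by
      have : a * (g - p * e) = s + s' * e := by
        have e1 : a * g = s + (p * a + s') * e := by rw [hps, hsw]
        linear_combination e1
      rw [this]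
      exact Ideal.add_mem _ hs (Ideal.mul_mem_right _ _ hs')
    have hg' := ih h1 hkey
    have : g = (g - p * e) + p * e := by ring
    rw [this]
    exact Ideal.add_mem _ (Ideal.mem_sup_left hg')
      (Ideal.mem_sup_right (Ideal.mem_span_singleton'.mpr ⟨p, rfl⟩))

/-- Iterated swap lemma: `aᴺ g ∈ (es) ⇒ g ∈ (es)` for `a :: es` weakly regular. [folklore] -/
theorem mem_of_pow_mul_mem_of_isWeaklyRegular_cons {B : Type*} [CommRing B] {a : B} {es : List B}
    (h : RingTheory.Sequence.IsWeaklyRegular B (a :: es)) :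
    ∀ (N : ℕ) {g : B}, a ^ N * g ∈ Ideal.ofList es → g ∈ Ideal.ofList es := by
  intro N
  induction N with
  | zero => intro g hg; rwa [pow_zero, one_mul] at hg
  | succ N ih =>
    intro g hg
    rw [pow_succ, mul_assoc] at hg
    exact mem_of_mul_mem_of_isWeaklyRegular_cons h (ih hg)

/-! ## The strict transform of `V(x_J)` on the chart `D₊(x_i t)` -/

section StrictTransform

variable {R : Type u} [CommRing R] {n n' a : ℕ} (x : Fin n → R) (emb : Fin n' → Fin n) (i' : Fin n')
  (jJ : Fin a → {j : Fin n // j ≠ emb i'})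

/-- The ideal `(x_j : j ∈ J)` of the coordinate subspace downstairs. -/
local notation3 "Q" => Ideal.span (Set.range fun k : Fin a => x (jJ k).1)
/-- The reduced family `x̄ = (x̄_{emb k})_k` over `R̄ = R/(x_J)`. -/
local notation3 "xb" => (fun k : Fin n' => Ideal.Quotient.mk
  (Ideal.span (Set.range fun k : Fin a => x (jJ k).1)) (x (emb k)))
/-- The ideal `(e_j : j ∈ J)` of the strict transform on the chart. -/
local notation3 "EJ" => Ideal.span (Set.range fun k : Fin a => chartGen x (emb i') (jJ k).1)

/-- `I (R/(x_J)) ⊆ (x̄_{emb k})_k` when `emb` and `J` cover all indices. [folklore] -/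
theorem map_span_le_span_red (hcov : ∀ j : Fin n, (∃ k, emb k = j) ∨ ∃ k, (jJ k).1 = j) :
    (Ideal.span (Set.range x)).map (Ideal.Quotient.mk Q) ≤ Ideal.span (Set.range xb) := by
  rw [Ideal.map_span, Ideal.span_le]
  rintro _ ⟨_, ⟨j, rfl⟩, rfl⟩
  rcases hcov j with ⟨k, rfl⟩ | ⟨k, hk⟩
  · exact Ideal.subset_span ⟨k, rfl⟩
  · have h0 : Ideal.Quotient.mk Q (x (jJ k).1) = 0 :=
      Ideal.Quotient.eq_zero_iff_mem.mpr (Ideal.subset_span ⟨k, rfl⟩)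
    rw [← hk, SetLike.mem_coe, h0]
    exact Ideal.zero_mem _

/-- `(x̄_{emb k})_k ⊆ I (R/(x_J))`. [folklore] -/
theorem span_red_le_map_span :
    Ideal.span (Set.range xb) ≤ (Ideal.span (Set.range x)).map (Ideal.Quotient.mk Q) := by
  rw [Ideal.span_le]
  rintro _ ⟨k, rfl⟩
  exact Ideal.mem_map_of_mem _ (Ideal.subset_span ⟨emb k, rfl⟩)

/-- `(x_J) · B = (x_i) · (e_J)` on the chart. [cite: StacksProject, Tag 0804] -/
theorem map_chartBase_Q :
    (Q).map (chartBase x (emb i')) = Ideal.span {chartBase x (emb i') (x (emb i'))} * EJ := by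
  have h := CoreRungTower.map_chartBase_span_comp x (fun k : Fin a => (jJ k).1) (emb i')
  simp only [Function.comp_def] at h
  exact h

/-- The chart family `(x_i, e_J)` as a list. [folklore] -/
theorem ofFn_chartFamily :
    List.ofFn (Fin.cons (chartBase x (emb i') (x (emb i'))) fun k => chartGen x (emb i') (jJ k).1) =
      chartBase x (emb i') (x (emb i')) :: List.ofFn fun k => chartGen x (emb i') (jJ k).1 := by
  rw [List.ofFn_succ]
  simp only [Fin.cons_zero, Fin.cons_succ]

/-- **`x_i` is regular modulo `(e_J)`**: `x_iᴺ g ∈ (e_J) ⇒ g ∈ (e_J)` (swap lemma on the chart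
family). [cite: StacksProject, Tag 0BIQ] -/
theorem mem_EJ_of_pow_mul_mem (hx : IsQuasiRegular x) (hjJ : Function.Injective jJ) (N : ℕ)
    {g : chartRing x (emb i')} (hg : chartBase x (emb i') (x (emb i')) ^ N * g ∈ EJ) : g ∈ EJ := by
  have hw := CoreRungTower.isWeaklyRegular_chartFamily x (emb i') jJ hx hjJ
  rw [ofFn_chartFamily] at hw
  have hEJ : Ideal.ofList (List.ofFn fun k => chartGen x (emb i') (jJ k).1) = EJ := Ideal.ofList_ofFn _
  rw [← hEJ] at hg ⊢
  exact mem_of_pow_mul_mem_of_isWeaklyRegular_cons hw N hg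

set_option maxHeartbeats 400000 in
/-- **THE STRICT TRANSFORM OF A COORDINATE SUB-FAMILY.** For `x` quasi-regular, the chart
`B = (R[It])_{(x_i t)}` modulo `(e_j : j ∈ J)` is the Rees chart `B̄` of the reduced family
`x̄ = (x̄_{emb k})_k` over `R̄ = R/(x_j : j ∈ J)` at `x̄_i`, by an isomorphism sending `r/1 ↦ r̄/1`
and `e_{emb k} ↦ ē_k` (GW Prop. 13.96 (2) for the subscheme `V(x_J) ⊇ V(I)`: its strict transform
is `Bl_Ī Spec R̄`; the ideal of the strict transform on the chart is the `x_i`-saturation of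
`(x_J) B = x_i (e_J)`, which is `(e_J)` by the swap lemma).
[cite: GortzWedhorn2020, Prop. 13.96 (2), p. 416] [cite: StacksProject, Tag 0BIQ] -/
theorem exists_strictTransformHom (hx : IsQuasiRegular x) (hjJ : Function.Injective jJ)
    (hcov : ∀ j : Fin n, (∃ k, emb k = j) ∨ ∃ k, (jJ k).1 = j) :
    ∃ Θ : (chartRing x (emb i') ⧸ EJ) →+* chartRing xb i', Function.Bijective Θ ∧
      (∀ r : R, Θ (Ideal.Quotient.mk EJ (chartBase x (emb i') r)) =
        chartBase xb i' (Ideal.Quotient.mk Q r)) ∧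
      (∀ k : Fin n', Θ (Ideal.Quotient.mk EJ (chartGen x (emb i') (emb k))) = chartGen xb i' k) := by
  classical
  have hIJ := map_span_le_span_red x emb i' jJ hcov
  have hJI := span_red_le_map_span x emb i' jJ
  -- the chart map `B → B̄` through the affine models
  let τ : chartRing x (emb i') →+* blowupAlgebra (Ideal.span (Set.range x)) (x (emb i')) :=
    blowupAlgebra.toBlowupAlgebra x (emb i')
  have hτ : Function.Bijective τ := blowupAlgebra.toBlowupAlgebra_bijective x (emb i')
  let Ψ₀ : blowupAlgebra (Ideal.span (Set.range x)) (x (emb i')) →+*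
      blowupAlgebra (Ideal.span (Set.range xb)) (xb i') :=
    blowupAlgebraMap (Ideal.Quotient.mk Q) (Ideal.span (Set.range x))
      (Ideal.span (Set.range xb)) (x (emb i')) hIJ
  let eT := RingEquiv.ofBijective (blowupAlgebra.toBlowupAlgebra xb i')
      (blowupAlgebra.toBlowupAlgebra_bijective xb i')
  let Ψ : chartRing x (emb i') →+* chartRing xb i' :=
    eT.symm.toRingHom.comp (Ψ₀.comp τ)
  -- values on the structure map and on the generators
  have hΨbase : ∀ r : R, Ψ (chartBase x (emb i') r) = chartBase xb i' (Ideal.Quotient.mk Q r) := by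
    intro r
    show eT.symm (Ψ₀ (τ (chartBase x (emb i') r))) = _
    rw [RingEquiv.symm_apply_eq]
    show Ψ₀ (blowupAlgebra.toBlowupAlgebra x (emb i') (chartBase x (emb i') r)) =
      blowupAlgebra.toBlowupAlgebra xb i' (chartBase xb i' (Ideal.Quotient.mk Q r))
    rw [blowupAlgebra.toBlowupAlgebra_reesChartBase, blowupAlgebra.toBlowupAlgebra_reesChartBase]
    exact blowupAlgebraMap_algebraMap _ _ _ _ hIJ r
  have hΨgen : ∀ j : Fin n, Ψ (chartGen x (emb i') j) =
      eT.symm (blowupAlgebra.gen (Ideal.span (Set.range xb)) (xb i')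
        (Ideal.Quotient.mk Q (x j)) (hIJ (Ideal.mem_map_of_mem _ (blowupAlgebra.mem_span_range x j)))) := by
    intro j
    show eT.symm (Ψ₀ (τ (chartGen x (emb i') j))) = _
    congr 1
    show Ψ₀ (blowupAlgebra.toBlowupAlgebra x (emb i') (chartGen x (emb i') j)) = _
    rw [blowupAlgebra.toBlowupAlgebra_chartGen]
    exact blowupAlgebraMap_gen _ _ _ _ hIJ (x j) (blowupAlgebra.mem_span_range x j)
  have hΨemb : ∀ k : Fin n', Ψ (chartGen x (emb i') (emb k)) = chartGen xb i' k := by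
    intro k
    rw [hΨgen, RingEquiv.symm_apply_eq]
    show _ = blowupAlgebra.toBlowupAlgebra xb i' (chartGen xb i' k)
    rw [blowupAlgebra.toBlowupAlgebra_chartGen]
  have hΨJ : ∀ k : Fin a, Ψ (chartGen x (emb i') (jJ k).1) = 0 := by
    intro k
    have h0 : Ideal.Quotient.mk Q (x (jJ k).1) = 0 :=
      Ideal.Quotient.eq_zero_iff_mem.mpr (Ideal.subset_span ⟨k, rfl⟩)
    rw [hΨgen, map_eq_zero_iff _ eT.symm.injective]
    apply Subtype.ext
    rw [blowupAlgebra.coe_gen, h0, map_zero, zero_mul]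
    simp
  -- surjectivity
  have hΨsurj : Function.Surjective Ψ := by
    intro z
    obtain ⟨w, hw⟩ := blowupAlgebraMap_surjective (Ideal.Quotient.mk Q) (Ideal.span (Set.range x))
      (Ideal.span (Set.range xb)) (x (emb i')) Ideal.Quotient.mk_surjective hIJ hJI (eT z)
    obtain ⟨g, hg⟩ := hτ.2 w
    refine ⟨g, ?_⟩
    show eT.symm (Ψ₀ (τ g)) = z
    rw [hg, RingEquiv.symm_apply_eq]
    exact hw
  -- the kernel is `(e_J)`
  have hker : EJ = RingHom.ker Ψ := by
    apply le_antisymm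
    · rw [Ideal.span_le]
      rintro _ ⟨k, rfl⟩
      rw [SetLike.mem_coe, RingHom.mem_ker]
      exact hΨJ k
    · intro g hg
      rw [RingHom.mem_ker] at hg
      have hg0 : Ψ₀ (τ g) = 0 := by
        have : eT.symm (Ψ₀ (τ g)) = 0 := hg
        rwa [map_eq_zero_iff _ eT.symm.injective] at this
      have hg1 := (mem_ker_blowupAlgebraMap_iff (Ideal.Quotient.mk Q) (Ideal.span (Set.range x))
        (Ideal.span (Set.range xb)) (x (emb i')) hIJ (τ g)).mp hg0
      rw [Ideal.mk_ker] at hg1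
      obtain ⟨N, hN⟩ := hg1
      -- pull back along the bijection `τ`
      have halg : τ.comp (chartBase x (emb i')) =
          algebraMap R (blowupAlgebra (Ideal.span (Set.range x)) (x (emb i'))) :=
        RingHom.ext fun r => blowupAlgebra.toBlowupAlgebra_reesChartBase x (emb i') r
      have e1 : τ (chartBase x (emb i') (x (emb i')) ^ N * g) =
          algebraMap R (blowupAlgebra (Ideal.span (Set.range x)) (x (emb i'))) (x (emb i')) ^ N * τ g := by
        rw [RingHom.map_mul, RingHom.map_pow, ← RingHom.comp_apply, halg]
      have e2 : (Q).map (algebraMap R (blowupAlgebra (Ideal.span (Set.range x)) (x (emb i')))) =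
          ((Q).map (chartBase x (emb i'))).map τ := by
        rw [Ideal.map_map, halg]
      have hN' : τ (chartBase x (emb i') (x (emb i')) ^ N * g) ∈ ((Q).map (chartBase x (emb i'))).map τ := by
        rw [e1, ← e2]
        exact hN
      obtain ⟨y, hy, hyg⟩ := (Ideal.mem_map_iff_of_surjective τ hτ.2).mp hN'
      have hyg' : y = chartBase x (emb i') (x (emb i')) ^ N * g := hτ.1 hyg
      rw [hyg', map_chartBase_Q] at hy
      exact mem_EJ_of_pow_mul_mem x emb i' jJ hx hjJ N (Ideal.mul_le_left hy)
  have hle : ∀ g ∈ EJ, Ψ g = 0 := fun g hg => by rw [hker] at hg; exact hg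
  refine ⟨Ideal.Quotient.lift EJ Ψ hle, ⟨?_, ?_⟩, fun r => ?_, fun k => ?_⟩
  · rw [RingHom.injective_iff_ker_eq_bot, Ideal.ker_quotient_lift, ← hker, Ideal.map_quotient_self]
  · exact Ideal.Quotient.lift_surjective_of_surjective EJ hle hΨsurj
  · rw [Ideal.Quotient.lift_mk]
    exact hΨbase r
  · rw [Ideal.Quotient.lift_mk]
    exact hΨemb k

/-- **`B ⧸ (e_J)` is a regular ring** when `R/(x_J)` is regular, the reduced family `x̄` is
quasi-regular and `R/(x_J, x) ` (`= R̄/Ī`) is regular (Liu Thm. 8.1.19 (a) on the chart `B̄`,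
`isRegularRing_blowupChart`, through `exists_strictTransformHom`).
[cite: Liu2002, Thm. 8.1.19 (a)] [cite: GortzWedhorn2020, Prop. 13.96 (2)] -/
theorem isRegularRing_quotient_span_chartGen (hx : IsQuasiRegular x) (hjJ : Function.Injective jJ)
    (hcov : ∀ j : Fin n, (∃ k, emb k = j) ∨ ∃ k, (jJ k).1 = j)
    (hRQ : IsRegularRing (R ⧸ Q)) (hxb : IsQuasiRegular xb)
    (hRI : IsRegularRing ((R ⧸ Q) ⧸ Ideal.span (Set.range xb))) :
    IsRegularRing (chartRing x (emb i') ⧸ EJ) := by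
  haveI := hRQ
  haveI := hRI
  obtain ⟨Θ, hΘ, -, -⟩ := exists_strictTransformHom x emb i' jJ hx hjJ hcov
  haveI : IsRegularRing (chartRing xb i') := isRegularRing_blowupChart xb i' hxb
  exact IsRegularRing.of_ringEquiv (R := chartRing xb i') (RingEquiv.ofBijective Θ hΘ).symm

/-- **Non-zero-divisors modulo `(x_J)` stay non-zero-divisors modulo `(e_J)`**: if `r̄` is a
non-zero-divisor of `R/(x_J)` then `r/1` is a non-zero-divisor of `B ⧸ (e_J)` (it maps to
`r̄/1 ∈ B̄`, a non-zero-divisor of the chart ring, GW Prop. 13.91 (4)).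
[cite: GortzWedhorn2020, Prop. 13.91 (4) (proof)] [cite: GortzWedhorn2020, Prop. 13.96 (2)] -/
theorem mk_chartBase_mem_nonZeroDivisors (hx : IsQuasiRegular x) (hjJ : Function.Injective jJ)
    (hcov : ∀ j : Fin n, (∃ k, emb k = j) ∨ ∃ k, (jJ k).1 = j) {r : R}
    (hr : Ideal.Quotient.mk Q r ∈ nonZeroDivisors (R ⧸ Q)) :
    Ideal.Quotient.mk EJ (chartBase x (emb i') r) ∈ nonZeroDivisors (chartRing x (emb i') ⧸ EJ) := by
  obtain ⟨Θ, hΘ, hΘbase, -⟩ := exists_strictTransformHom x emb i' jJ hx hjJ hcov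
  refine mem_nonZeroDivisors_of_injective (f := Θ) hΘ.1 ?_
  rw [hΘbase]
  exact reesChartBase_mem_nonZeroDivisors_of_mem_nonZeroDivisors (I := Ideal.span (Set.range xb))
    (xb i') (Ideal.mem_span_range_self (f := xb) (x := i')) hr

end StrictTransform

end ChartStrictTransform

end Summit.ResolutionOfSingularities.ResolutionOfSingularities.Theorems

end
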